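import Summits.KontsevichZagierPeriods.KontsevichZagierPeriods.Theorems.SymplecticScissorsPlanarCompilerStubElementaryMovesAux
import Literature.NumberTheory.Transcendental.KZSemialgebraicComplex

/-!
# `PlanarK0Injective`, algebraic-area layer — helper: translating a strip

Helper of the (unconditional) algebraic-area layer of crux stmt-KontsevichZagierPeriods-9847
(`PlanarK0Injective`, route SymplecticScissors, line lead seat c5).

Two integrand-`1` planar representations on the unit-height strips `(a, b) × (0, 1)` and
`(a', b') × (0, 1)` of equal width, with `a` and `a'` real-algebraic, differ in the planar
set-chain group `G = planarGroup` by ONE rule-2 instance: the horizontal translation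
`q ↦ q + (a' − a, 0)`, which is `ℚ`-semialgebraic (its shift is algebraic), injective, has
derivative the identity (determinant `1`) and maps the first strip onto the second.
-/

noncomputable section

open MeasureTheory Set
open Literature.NumberTheory.Transcendental Literature.ModelTheory.ExponentialFields
open Summit.KontsevichZagierPeriods.SymplecticScissors.PlanarK0InjectiveNegative
open Summit.KontsevichZagierPeriods.SymplecticScissors.PlanarCompilerProof.ElementaryMoves

namespace Summit.KontsevichZagierPeriods.SymplecticScissors.PlanarK0InjectiveAlgebraicLayer

/-- **Two unit-height strips of equal width with algebraic left ends differ by one translation.**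
If `R`, `R'` are integrand-`1` planar representations on `(a, b) × (0, 1)` and `(a', b') × (0, 1)`
with `b − a = b' − a'` and `a`, `a'` algebraic over `ℚ`, then `[R] − [R'] ∈ G`: the translation
`q ↦ q + (a' − a, 0)` is a `ℚ`-semialgebraic injective map with `|det| = 1` of the first domain
onto the second, i.e. a planar rule-2 instance. (The hypothesis `a < b` is not used: for `b ≤ a`
both strips are empty.) [Kontsevich–Zagier 2001, §1.2, rule (2)] [folklore] -/
theorem strip_sub_strip_mem_planarGroup {a b a' b' : ℝ} (ha : IsAlgebraic ℚ a)
    (ha' : IsAlgebraic ℚ a') (hab : a < b) (hlen : b - a = b' - a') (R R' : KZ.IntegralRep 2)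
    (hR : R.domain = {q : Fin 2 → ℝ | q 0 ∈ Ioo a b ∧ q 1 ∈ Ioo (0 : ℝ) 1})
    (hR' : R'.domain = {q : Fin 2 → ℝ | q 0 ∈ Ioo a' b' ∧ q 1 ∈ Ioo (0 : ℝ) 1})
    (h1 : ∀ q ∈ R.domain, R.integrand q = 1) (h1' : ∀ q ∈ R'.domain, R'.integrand q = 1) :
    KZ.of R - KZ.of R' ∈ planarGroup := by
  -- `a < b` is not needed below (for `b ≤ a` both strips are empty)
  have _ := hab
  have hdomS : IsSemialgebraic ℚ R.domain := R.isSemialgebraic_domain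
  -- the translation vector and the translation
  set v : Fin 2 → ℝ := ![a' - a, 0] with hv
  set Ψ : (Fin 2 → ℝ) → (Fin 2 → ℝ) := fun q => q + v with hΨ
  have hΨ0 : ∀ q, Ψ q 0 = q 0 + (a' - a) := fun q => by
    simp only [hΨ, hv, Pi.add_apply, Matrix.cons_val_zero]
  have hΨ1 : ∀ q, Ψ q 1 = q 1 := fun q => by
    simp only [hΨ, hv, Pi.add_apply, Matrix.cons_val_one, Matrix.cons_val_fin_one, add_zero]
  -- `Ψ` is `ℚ`-semialgebraic: its coordinates are `x + (a' - a)` (algebraic constant) and `y`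
  have hmap : IsSemialgebraicMapOn ℚ R.domain Ψ := by
    refine IsSemialgebraicMapOn.of_forall hdomS fun j => ?_
    fin_cases j
    · exact (IsSemialgebraicFunOn.add_holds (isSemialgebraicFunOn_apply hdomS (0 : Fin 2))
        (isSemialgebraicFunOn_const_of_isAlgebraic hdomS (ha'.sub ha))).congr
          fun q _ => by simp [hΨ0]
    · exact (isSemialgebraicFunOn_apply hdomS (1 : Fin 2)).congr fun q _ => by simp [hΨ1]
  -- derivative: the identity
  have hd : ∀ q ∈ R.domain,
      HasFDerivWithinAt Ψ (ContinuousLinearMap.id ℝ (Fin 2 → ℝ)) R.domain q :=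
    fun q _ => ((hasFDerivAt_id q).add_const v).hasFDerivWithinAt
  have hdet : ∀ q ∈ R.domain, |(ContinuousLinearMap.id ℝ (Fin 2 → ℝ)).det| = 1 :=
    fun q _ => by simp [ContinuousLinearMap.det]
  -- injectivity
  have hinj : InjOn Ψ R.domain := fun p _ q _ hpq => add_right_cancel hpq
  -- image: the second strip
  have hdom : R'.domain = Ψ '' R.domain := by
    rw [hR, hR']
    ext q
    simp only [mem_image, mem_setOf_eq, mem_Ioo]
    constructor
    · rintro ⟨⟨hq0a, hq0b⟩, hq1⟩
      refine ⟨q - v, ⟨⟨?_, ?_⟩, ?_⟩, sub_add_cancel q v⟩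
      · simp only [hv, Pi.sub_apply, Matrix.cons_val_zero]; linarith
      · simp only [hv, Pi.sub_apply, Matrix.cons_val_zero]; linarith
      · simpa [hv] using hq1
    · rintro ⟨p, ⟨⟨hp0a, hp0b⟩, hp1⟩, rfl⟩
      refine ⟨⟨?_, ?_⟩, ?_⟩
      · rw [hΨ0]; linarith
      · rw [hΨ0]; linarith
      · rw [hΨ1]; exact hp1
  exact sub_mem_planarGroup_of_map R R' h1 h1' (Ψ' := fun _ => ContinuousLinearMap.id ℝ _)
    hmap hd hinj hdet hdom

/-! ## Registered anchor -/

/-- **Registered-stub anchor** (binder-explicit form of `strip_sub_strip_mem_planarGroup`, the stub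
`Strip` of the algebraic-area layer of crux stmt-KontsevichZagierPeriods-9847): two integrand-`1`
representations on unit-height strips of equal width with algebraic left ends differ by one
translation in the planar set-chain group. [Kontsevich–Zagier 2001, §1.2, rule (2)] [folklore] -/
theorem helper_algebraicLayer_strip :
    ∀ (a b a' b' : ℝ), IsAlgebraic ℚ a → IsAlgebraic ℚ a' → a < b → b - a = b' - a' →
      ∀ (R R' : KZ.IntegralRep 2),
        R.domain = {q : Fin 2 → ℝ | q 0 ∈ Set.Ioo a b ∧ q 1 ∈ Set.Ioo (0 : ℝ) 1} →
        R'.domain = {q : Fin 2 → ℝ | q 0 ∈ Set.Ioo a' b' ∧ q 1 ∈ Set.Ioo (0 : ℝ) 1} →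
        (∀ q ∈ R.domain, R.integrand q = 1) → (∀ q ∈ R'.domain, R'.integrand q = 1) →
        KZ.of R - KZ.of R' ∈ planarGroup :=
  fun _ _ _ _ ha ha' hab hlen R R' hR hR' h1 h1' =>
    strip_sub_strip_mem_planarGroup ha ha' hab hlen R R' hR hR' h1 h1'

end Summit.KontsevichZagierPeriods.SymplecticScissors.PlanarK0InjectiveAlgebraicLayer
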